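import Literature.MathematicalPhysics.QuantumFieldTheory.Balaban1983to89.B7Prop1Explicit
import Literature.MathematicalPhysics.QuantumFieldTheory.Balaban1983to89.T4AveragingDeficitWallBoundary
import Mathlib.Algebra.Order.Chebyshev
import HarnessLib

/-!
# `UnitScaleTiltProp7CornerCombFlatJensen` — the A-slot of the cornered comb tower: Jensen for the STRAIGHT tower, one step and `k`-fold,
with the column count (each fine bond is hit by at most `L` coarse triples per step)

«(O2) groundwork — not consumed by any displayed row before the freeze lifts» (★★OWNER ym3-torus-plan g29 RULINGS №19 (O2), №20 (2),
№22 (c); «(II) GO» of record 2026-08-29T06:31:31Z; pen II-2 named by ★routeR-w1 g9 06:35:17Z).  Companion of II-1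
✓`UnitScaleTiltProp7CornerCombFlatStructure` (`B k = S k − dΘ_k`: the `k`-fold cornered comb functional = the STRAIGHT tower `S` + corner terms).
This file prices the straight tower — the A-slot of `hMcomb`'s split currency `A·L⁻ᵏ·M₀ + B·Lᵏ·KD` with the SHARP constant (★routeR-w6 PREREAD
6d5726a1 (R1) «JENSEN `Σ_c|S⁽ᵏ⁾A(c)|² ≤ L^{(2−d)k}M₀`», ★routeR-w4 FLATCORE 85b2c314 §2(i), FALSIFIER v1.1 (M1): `Q⁽ᵏ⁾ = Lᵏ` on constants).

OBJECTS (lit `B7Prop1Explicit` letters `asum`, `seg`, `boxVec`, `e`): a straight step is the recursion hypothesis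
`Sm1 z κ = Σ_{r : Fin d → Fin L} L⁻ᵈ • asum Sm (L•z + boxVec L r) (seg κ L)` (print's (125) main term `Q₀` [Balaban1985Averaging] at trivial
transporters, rescaled to `ℤᵈ`), i.e. `Sm1 z κ = Σ_r Σ_{t<L} L⁻ᵈ • Sm (L•z + r + t•e_κ) κ` — `Lᵈ·L` terms of weight `L⁻ᵈ` (★`straight_step_eq_sum`).
RESULTS: ★`straight_step_normSq_le` — POINTWISE JENSEN `‖Sm1 z κ‖² ≤ L·L⁻ᵈ·Σ_{r,t}‖Sm (L•z + r + t•e_κ) κ‖²`; lit ✓`blockMap_injective` + ★`card_fiber_le` — the map `(z, r, t) ↦ L•z + r + t•e_κ` has fibres of size `≤ L` (Euclidean division in each coordinate; one preimage per `t`);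
★★`straight_step_sum_normSq_le_fold` — the SUMMED step through any «fold» `Site d → ι` with fibre multiplicity `≤ L` (the torus∕period-cell user
supplies the fold = reduction mod the period; F-0∕F-8 of ★routeR-w1's list): `Σ_{z∈Zc}‖Sm1 z κ‖² ≤ L²·L⁻ᵈ·Σ_{i∈Zf} T i`;
★★`straight_step_sum_normSq_le` — the `ℤᵈ` case (fold = id, multiplicity automatic): `Σ_{z∈Zc}‖Sm1 z κ‖² ≤ L²L⁻ᵈ·Σ_{y∈Zf}‖Sm y κ‖²` for any
`Zf ⊇` the image; ★★★`straight_tower_sum_normSq_le` — `k`-fold along a chain of finite site sets `Z m` absorbing the images: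
`Σ_{z∈Z k}‖S k z κ‖² ≤ (L²·L⁻ᵈ)ᵏ·Σ_{y∈Z 0}‖S 0 y κ‖²`; `weight_pow_d3` — in `d = 3` the factor is `(Lᵏ)⁻¹`, i.e. `Σ_c‖S⁽ᵏ⁾A(c)‖² ≤ L⁻ᵏ·M₀`
per direction once the period cell is folded exactly (constant `1`; with the crude `Zf ⊇ image` on `ℤ³` the overhang costs at most a factor `2`).
Any `d`, any `L ≥ 1`, `𝔸` any normed ring that is a real normed space.
HONEST: elementary (Jensen + counting); nothing of `hMcomb` ∕ `hMcomb₂` ∕ (β) ∕ `hD` ∕ the crux 19200 is proved or claimed; rung R3 (YM₃ on T³),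
not d = 4, not infinite volume, not a mass gap, not Clay.
-/

open scoped BigOperators
open Finset
open Literature.MathematicalPhysics.QuantumFieldTheory.Balaban1983to89.B7Prop1Explicit
open Literature.MathematicalPhysics.QuantumFieldTheory.Balaban1983to89.T4AveragingDeficitWallBoundary (blockMap_injective)

namespace Summit.QuantumFields.YangMills.Theorems.Prop7CornerCombFlatJensen

variable {d : ℕ} {𝔸 : Type*} [NormedRing 𝔸] [NormedSpace ℝ 𝔸]

/-! ## §1 One straight step as a weighted sum of `Lᵈ·L` bond values -/

/-- A straight step, unfolded: `Sm1 z κ = Σ_r Σ_{t<L} L⁻ᵈ • Sm (L•z + r + t•e_κ) κ` (lit `asum_seg_natCast`). [cite: Balaban1985Averaging, (125) p.36] -/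
theorem straight_step_eq_sum (L : ℕ) (Sm Sm1 : Site d → Fin d → 𝔸) (z : Site d) (κ : Fin d)
    (h : Sm1 z κ = ∑ r : Fin d → Fin L, (((L : ℝ) ^ d)⁻¹) • asum Sm ((L : ℤ) • z + boxVec L r) (seg κ (L : ℤ))) :
    Sm1 z κ = ∑ r : Fin d → Fin L, ∑ t ∈ Finset.range L,
      (((L : ℝ) ^ d)⁻¹) • Sm ((L : ℤ) • z + boxVec L r + (t : ℤ) • e κ) κ := by
  rw [h]
  refine Finset.sum_congr rfl fun r _ => ?_
  rw [asum_seg_natCast, Finset.smul_sum]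

/-! ## §2 Pointwise Jensen for one straight step -/

/-- ★ **POINTWISE JENSEN**: `‖Sm1 z κ‖² ≤ L·L⁻ᵈ·Σ_{r,t}‖Sm (L•z + r + t•e_κ) κ‖²` — `Lᵈ·L` terms of weight `L⁻ᵈ` (weights summing to `L`).
[folklore] [cite: Balaban1985Averaging, (125) p.36] -/
theorem straight_step_normSq_le (L : ℕ) (Sm Sm1 : Site d → Fin d → 𝔸) (z : Site d) (κ : Fin d)
    (h : Sm1 z κ = ∑ r : Fin d → Fin L, (((L : ℝ) ^ d)⁻¹) • asum Sm ((L : ℤ) • z + boxVec L r) (seg κ (L : ℤ))) :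
    ‖Sm1 z κ‖ ^ 2 ≤ (L : ℝ) * ((L : ℝ) ^ d)⁻¹ *
      ∑ r : Fin d → Fin L, ∑ t ∈ Finset.range L, ‖Sm ((L : ℤ) • z + boxVec L r + (t : ℤ) • e κ) κ‖ ^ 2 := by
  set c : ℝ := ((L : ℝ) ^ d)⁻¹ with hc
  have hc0 : 0 ≤ c := by positivity
  set f : (Fin d → Fin L) × ℕ → 𝔸 := fun p => Sm ((L : ℤ) • z + boxVec L p.1 + (p.2 : ℤ) • e κ) κ with hf
  set I : Finset ((Fin d → Fin L) × ℕ) := (Finset.univ : Finset (Fin d → Fin L)) ×ˢ Finset.range L with hI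
  -- the step as ONE sum over the index set `I`
  have hsum : Sm1 z κ = ∑ p ∈ I, c • f p := by
    rw [straight_step_eq_sum L Sm Sm1 z κ h, hI, Finset.sum_product]
  have hsum2 : ∑ r : Fin d → Fin L, ∑ t ∈ Finset.range L, ‖Sm ((L : ℤ) • z + boxVec L r + (t : ℤ) • e κ) κ‖ ^ 2
      = ∑ p ∈ I, ‖f p‖ ^ 2 := by
    rw [hI, Finset.sum_product]
  have hcard : (#I : ℝ) = (L : ℝ) ^ d * L := by
    rw [hI, Finset.card_product, Finset.card_univ, Fintype.card_fun, Fintype.card_fin, Fintype.card_fin, Finset.card_range]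
    push_cast; ring
  -- triangle inequality, then `(Σ a_i)² ≤ #I · Σ a_i²`
  have h1 : ‖Sm1 z κ‖ ≤ ∑ p ∈ I, c * ‖f p‖ := by
    rw [hsum]
    refine (norm_sum_le _ _).trans (Finset.sum_le_sum fun p _ => ?_)
    exact (norm_smul_le _ _).trans (by rw [Real.norm_of_nonneg hc0])
  have h2 : ‖Sm1 z κ‖ ^ 2 ≤ (∑ p ∈ I, c * ‖f p‖) ^ 2 := pow_le_pow_left₀ (norm_nonneg _) h1 2
  have h3 : (∑ p ∈ I, c * ‖f p‖) ^ 2 ≤ #I * ∑ p ∈ I, (c * ‖f p‖) ^ 2 := sq_sum_le_card_mul_sum_sq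
  rw [hsum2]
  calc ‖Sm1 z κ‖ ^ 2 ≤ #I * ∑ p ∈ I, (c * ‖f p‖) ^ 2 := h2.trans h3
    _ = (L : ℝ) * ((L : ℝ) ^ d)⁻¹ * ∑ p ∈ I, ‖f p‖ ^ 2 := by
      rw [hcard]
      simp only [mul_pow, ← Finset.mul_sum, hc]
      have hLd : ((L : ℝ) ^ d) ≠ 0 ∨ L = 0 := by
        by_cases hL : L = 0
        · exact Or.inr hL
        · exact Or.inl (pow_ne_zero _ (by exact_mod_cast hL))
      rcases hLd with hLd | hL0
      · field_simp
      · subst hL0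
        rcases Nat.eq_zero_or_pos d with hd | hd
        · subst hd; simp
        · simp [zero_pow hd.ne']

/-! ## §3 The column count: `(z, r, t) ↦ L•z + r + t•e_κ` has fibres of size at most `L` (the block decomposition `(z, r) ↦ L•z + r` is
injective: lit ✓`T4AveragingDeficitWallBoundary.blockMap_injective`, imported) -/

/-- ★ **Fibres have at most `L` points**: among triples `(z, r, t)` with `t < L`, at most `L` map to a given site under
`(z, r, t) ↦ L•z + boxVec L r + t•e_κ` (one per value of `t`). [folklore] -/
theorem card_fiber_le (L : ℕ) (hL : 1 ≤ L) (κ : Fin d) (s : Finset (Site d × ((Fin d → Fin L) × ℕ)))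
    (hs : ∀ p ∈ s, p.2.2 < L) (y : Site d) :
    #{p ∈ s | (L : ℤ) • p.1 + boxVec L p.2.1 + (p.2.2 : ℤ) • e κ = y} ≤ L := by
  classical
  calc #{p ∈ s | (L : ℤ) • p.1 + boxVec L p.2.1 + (p.2.2 : ℤ) • e κ = y}
      ≤ #(Finset.range L) := by
        refine Finset.card_le_card_of_injOn (fun p => p.2.2) (fun p hp => ?_) (fun p hp p' hp' ht => ?_)
        · simp only [Finset.coe_filter, Set.mem_setOf_eq] at hp
          simp only [Finset.coe_range, Set.mem_Iio]
          exact hs p hp.1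
        · simp only [Finset.coe_filter, Set.mem_setOf_eq] at hp hp'
          simp only at ht
          have hzr : (L : ℤ) • p.1 + boxVec L p.2.1 = (L : ℤ) • p'.1 + boxVec L p'.2.1 := by
            have := hp.2.trans hp'.2.symm
            rw [ht] at this
            exact add_right_cancel this
          have := blockMap_injective L hL (a₁ := (p.1, p.2.1)) (a₂ := (p'.1, p'.2.1)) hzr
          simp only [Prod.mk.injEq] at this
          exact Prod.ext this.1 (Prod.ext this.2 ht)
    _ = L := Finset.card_range L

/-! ## §4 The summed step -/

/-- ★★ **SUMMED JENSEN THROUGH A FOLD** (period-cell form): let `fold : Site d → ι` send fine sites to classes (e.g. reduction modulo the period),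
`T : ι → ℝ` dominate `‖Sm y κ‖²` on the class of `y`, and suppose every class `i ∈ Zf` is hit by at most `L` of the triples
`(z, r, t) ∈ Zc × [0,L)ᵈ × [0,L)` through `fold (L•z + r + t•e_κ)`.  Then `Σ_{z∈Zc} ‖Sm1 z κ‖² ≤ L²·L⁻ᵈ·Σ_{i∈Zf} T i`
(= `L^{2−d}`: the sharp one-step A-slot constant). [folklore] [cite: Balaban1985Averaging, (125) p.36] -/
theorem straight_step_sum_normSq_le_fold (L : ℕ) (Sm Sm1 : Site d → Fin d → 𝔸) (κ : Fin d)
    (h : ∀ z : Site d, Sm1 z κ = ∑ r : Fin d → Fin L, (((L : ℝ) ^ d)⁻¹) • asum Sm ((L : ℤ) • z + boxVec L r) (seg κ (L : ℤ)))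
    (Zc : Finset (Site d)) {ι : Type*} [DecidableEq ι] (fold : Site d → ι) (Zf : Finset ι) (T : ι → ℝ)
    (hT : ∀ z ∈ Zc, ∀ (r : Fin d → Fin L) (t : ℕ), t < L →
      ‖Sm ((L : ℤ) • z + boxVec L r + (t : ℤ) • e κ) κ‖ ^ 2 ≤ T (fold ((L : ℤ) • z + boxVec L r + (t : ℤ) • e κ)))
    (hmaps : ∀ z ∈ Zc, ∀ (r : Fin d → Fin L) (t : ℕ), t < L → fold ((L : ℤ) • z + boxVec L r + (t : ℤ) • e κ) ∈ Zf)
    (hT0 : ∀ i ∈ Zf, 0 ≤ T i)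
    (hmult : ∀ i ∈ Zf, #{p ∈ Zc ×ˢ ((Finset.univ : Finset (Fin d → Fin L)) ×ˢ Finset.range L) |
        fold ((L : ℤ) • p.1 + boxVec L p.2.1 + (p.2.2 : ℤ) • e κ) = i} ≤ L) :
    ∑ z ∈ Zc, ‖Sm1 z κ‖ ^ 2 ≤ (L : ℝ) ^ 2 * ((L : ℝ) ^ d)⁻¹ * ∑ i ∈ Zf, T i := by
  classical
  set P : Finset (Site d × ((Fin d → Fin L) × ℕ)) := Zc ×ˢ ((Finset.univ : Finset (Fin d → Fin L)) ×ˢ Finset.range L) with hP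
  set π : Site d × ((Fin d → Fin L) × ℕ) → Site d := fun p => (L : ℤ) • p.1 + boxVec L p.2.1 + (p.2.2 : ℤ) • e κ with hπ
  have hc0 : 0 ≤ (L : ℝ) * ((L : ℝ) ^ d)⁻¹ := by positivity
  -- pointwise Jensen summed over `Zc`, written over the product index set
  have h1 : ∑ z ∈ Zc, ‖Sm1 z κ‖ ^ 2 ≤ (L : ℝ) * ((L : ℝ) ^ d)⁻¹ * ∑ p ∈ P, T (fold (π p)) := by
    calc ∑ z ∈ Zc, ‖Sm1 z κ‖ ^ 2
        ≤ ∑ z ∈ Zc, (L : ℝ) * ((L : ℝ) ^ d)⁻¹ *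
            ∑ r : Fin d → Fin L, ∑ t ∈ Finset.range L, ‖Sm ((L : ℤ) • z + boxVec L r + (t : ℤ) • e κ) κ‖ ^ 2 :=
          Finset.sum_le_sum fun z _ => straight_step_normSq_le L Sm Sm1 z κ (h z)
      _ ≤ ∑ z ∈ Zc, (L : ℝ) * ((L : ℝ) ^ d)⁻¹ *
            ∑ r : Fin d → Fin L, ∑ t ∈ Finset.range L, T (fold ((L : ℤ) • z + boxVec L r + (t : ℤ) • e κ)) := by
          refine Finset.sum_le_sum fun z hz => mul_le_mul_of_nonneg_left ?_ hc0
          exact Finset.sum_le_sum fun r _ => Finset.sum_le_sum fun t ht => hT z hz r t (Finset.mem_range.mp ht)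
      _ = (L : ℝ) * ((L : ℝ) ^ d)⁻¹ * ∑ p ∈ P, T (fold (π p)) := by
          rw [← Finset.mul_sum, hP, Finset.sum_product]
          simp only [Finset.sum_product, hπ]
  -- regroup by the fold class and use the multiplicity bound
  have h2 : ∑ p ∈ P, T (fold (π p)) ≤ (L : ℝ) * ∑ i ∈ Zf, T i := by
    rw [Finset.sum_comp (s := P) (f := T) (g := fun p => fold (π p))]
    have hsub : P.image (fun p => fold (π p)) ⊆ Zf := by
      intro i hi
      obtain ⟨p, hp, rfl⟩ := Finset.mem_image.mp hi
      rw [hP, Finset.mem_product, Finset.mem_product] at hp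
      exact hmaps p.1 hp.1 p.2.1 p.2.2 (Finset.mem_range.mp hp.2.2)
    calc ∑ i ∈ P.image (fun p => fold (π p)), (#{p ∈ P | fold (π p) = i}) • T i
        ≤ ∑ i ∈ P.image (fun p => fold (π p)), (L : ℝ) * T i := by
          refine Finset.sum_le_sum fun i hi => ?_
          rw [nsmul_eq_mul]
          exact mul_le_mul_of_nonneg_right (by exact_mod_cast hmult i (hsub hi)) (hT0 i (hsub hi))
      _ ≤ ∑ i ∈ Zf, (L : ℝ) * T i :=
          Finset.sum_le_sum_of_subset_of_nonneg hsub fun i hi _ => mul_nonneg (Nat.cast_nonneg _) (hT0 i hi)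
      _ = (L : ℝ) * ∑ i ∈ Zf, T i := by rw [Finset.mul_sum]
  calc ∑ z ∈ Zc, ‖Sm1 z κ‖ ^ 2 ≤ (L : ℝ) * ((L : ℝ) ^ d)⁻¹ * ∑ p ∈ P, T (fold (π p)) := h1
    _ ≤ (L : ℝ) * ((L : ℝ) ^ d)⁻¹ * ((L : ℝ) * ∑ i ∈ Zf, T i) := mul_le_mul_of_nonneg_left h2 hc0
    _ = (L : ℝ) ^ 2 * ((L : ℝ) ^ d)⁻¹ * ∑ i ∈ Zf, T i := by ring

/-- ★★ **SUMMED JENSEN ON `ℤᵈ`** (fold = identity; the multiplicity `≤ L` is automatic by ★`card_fiber_le`): for every finite set `Zc` of coarse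
sites and every finite `Zf` containing all `L•z + r + t•e_κ`, `z ∈ Zc`, `r ∈ [0,L)ᵈ`, `t < L`:
`Σ_{z∈Zc} ‖Sm1 z κ‖² ≤ L²·L⁻ᵈ·Σ_{y∈Zf} ‖Sm y κ‖²`. [folklore] [cite: Balaban1985Averaging, (125) p.36] -/
theorem straight_step_sum_normSq_le (L : ℕ) (hL : 1 ≤ L) (Sm Sm1 : Site d → Fin d → 𝔸) (κ : Fin d)
    (h : ∀ z : Site d, Sm1 z κ = ∑ r : Fin d → Fin L, (((L : ℝ) ^ d)⁻¹) • asum Sm ((L : ℤ) • z + boxVec L r) (seg κ (L : ℤ)))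
    (Zc Zf : Finset (Site d))
    (hZf : ∀ z ∈ Zc, ∀ (r : Fin d → Fin L) (t : ℕ), t < L → (L : ℤ) • z + boxVec L r + (t : ℤ) • e κ ∈ Zf) :
    ∑ z ∈ Zc, ‖Sm1 z κ‖ ^ 2 ≤ (L : ℝ) ^ 2 * ((L : ℝ) ^ d)⁻¹ * ∑ y ∈ Zf, ‖Sm y κ‖ ^ 2 := by
  classical
  refine straight_step_sum_normSq_le_fold L Sm Sm1 κ h Zc id Zf (fun y => ‖Sm y κ‖ ^ 2) (fun z _ r t _ => le_rfl) hZf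
    (fun i _ => by positivity) fun y _ => ?_
  refine card_fiber_le L hL κ _ (fun p hp => ?_) y
  rw [Finset.mem_product, Finset.mem_product] at hp
  exact Finset.mem_range.mp hp.2.2

/-! ## §5 The `k`-fold straight tower -/

/-- ★★★ **JENSEN FOR THE STRAIGHT TOWER** along a chain of finite site sets absorbing the images: if `S (m+1)` is the straight step of `S m`
(direction `κ`) and `L•z + r + t•e_κ ∈ Z m` whenever `z ∈ Z (m+1)`, then `Σ_{z∈Z k} ‖S k z κ‖² ≤ (L²·L⁻ᵈ)ᵏ · Σ_{y∈Z 0} ‖S 0 y κ‖²`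
— the A-slot of the split currency (`d = 3`: `L⁻ᵏ`, ★`weight_pow_d3`). «(O2) groundwork — not consumed by any displayed row before the freeze lifts.»
[folklore] [cite: Balaban1985Averaging, (125) p.36, (43) p.24] -/
theorem straight_tower_sum_normSq_le (L : ℕ) (hL : 1 ≤ L) (S : ℕ → Site d → Fin d → 𝔸) (κ : Fin d)
    (hS : ∀ (m : ℕ) (z : Site d),
      S (m + 1) z κ = ∑ r : Fin d → Fin L, (((L : ℝ) ^ d)⁻¹) • asum (S m) ((L : ℤ) • z + boxVec L r) (seg κ (L : ℤ)))
    (Z : ℕ → Finset (Site d))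
    (hZ : ∀ (m : ℕ), ∀ z ∈ Z (m + 1), ∀ (r : Fin d → Fin L) (t : ℕ), t < L → (L : ℤ) • z + boxVec L r + (t : ℤ) • e κ ∈ Z m)
    (k : ℕ) :
    ∑ z ∈ Z k, ‖S k z κ‖ ^ 2 ≤ ((L : ℝ) ^ 2 * ((L : ℝ) ^ d)⁻¹) ^ k * ∑ y ∈ Z 0, ‖S 0 y κ‖ ^ 2 := by
  induction k with
  | zero => simp
  | succ k ih =>
    have hstep := straight_step_sum_normSq_le L hL (S k) (S (k + 1)) κ (hS k) (Z (k + 1)) (Z k) (hZ k)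
    have hc0 : 0 ≤ (L : ℝ) ^ 2 * ((L : ℝ) ^ d)⁻¹ := by positivity
    calc ∑ z ∈ Z (k + 1), ‖S (k + 1) z κ‖ ^ 2 ≤ (L : ℝ) ^ 2 * ((L : ℝ) ^ d)⁻¹ * ∑ y ∈ Z k, ‖S k y κ‖ ^ 2 := hstep
      _ ≤ (L : ℝ) ^ 2 * ((L : ℝ) ^ d)⁻¹ * (((L : ℝ) ^ 2 * ((L : ℝ) ^ d)⁻¹) ^ k * ∑ y ∈ Z 0, ‖S 0 y κ‖ ^ 2) :=
          mul_le_mul_of_nonneg_left ih hc0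
      _ = ((L : ℝ) ^ 2 * ((L : ℝ) ^ d)⁻¹) ^ (k + 1) * ∑ y ∈ Z 0, ‖S 0 y κ‖ ^ 2 := by ring

/-- In three dimensions the `k`-fold weight is `(Lᵏ)⁻¹`: `(L²·L⁻³)ᵏ = (Lᵏ)⁻¹` — the A-slot `A·M₀·(Lᵏ)⁻¹` of `hMcomb` with `A = 1` per direction.
[folklore] -/
theorem weight_pow_d3 (L : ℕ) (hL : 1 ≤ L) (k : ℕ) :
    ((L : ℝ) ^ 2 * ((L : ℝ) ^ 3)⁻¹) ^ k = ((L : ℝ) ^ k)⁻¹ := by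
  have hL0 : (L : ℝ) ≠ 0 := by exact_mod_cast (show L ≠ 0 by omega)
  have h : (L : ℝ) ^ 2 * ((L : ℝ) ^ 3)⁻¹ = (L : ℝ)⁻¹ := by
    rw [show (L : ℝ) ^ 3 = (L : ℝ) ^ 2 * L by ring, mul_inv, ← mul_assoc, mul_inv_cancel₀ (pow_ne_zero 2 hL0), one_mul]
  rw [h, inv_pow]

end Summit.QuantumFields.YangMills.Theorems.Prop7CornerCombFlatJensen
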